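import Mathlib
import HarnessLib
import Summits.HubbardSuperconductivity.HubbardSuperconductivity.Theorems.KLProgrammeKLRegimeSplitEdgeFactsTransfer

/-!
# Route `KLProgramme` — edge facts for the pair masses AT THE PIN and ACROSS TRANSFERS: the pinned mass is an overlap sum, the diagonal bubble of an even
# symbol is MAXIMAL at zero transfer, and the symmetrised mixed mass is dominated by the two pinned diagonal bubbles (polarization)

Cell gate-hubbard-kl, seat hubbard-kl-k3c1-p1 (g20; child-1 lineage).  Model-level bricks in the vocabulary of `…KLRegimeSplitEdgeFactsTransfer` (`klBubbleSum`,
`klBubbleMass`, `klTransferWeight`) for the E1 docket item (5′)(s2) «SUP-VS-PIN» after rows 13/14 (`…SWaveCascadePinnedDomination`, `…SWaveCascadeTransferDifferences`),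
which reduce (s2) to two mass-level rows — the SHORTFALL (D2) and the PINNED SCREENING FLOOR (D3) `b_lo ≤ W_n(0)`.  Here (pen g25 (R391)(B); bus 2026-08-29 ≈07:32Z):

* §1 the frame propagator is even in the momentum (`propCT_neg_momentum`, from `nambuXiCT_neg`), and with `ĝ_K(−ν,·) = conj ĝ_K(ν,·)` (`propCT_revFreq`) every term of the
  pair sum of symbols even in the frequency is a product `g^a_ν(p)·conj g^b_ν(Q − p)`, `g^e_ν(p) := e(ν,p)·ĝ_K(ν,p)` (`klBubbleMass_eq_re_sum_conj`);
* §2 AT THE PIN `Q = 0` the pair mass of `a` against a symbol `b` even in frequency AND momentum is the OVERLAP SUM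
  **`klBubbleMass β μ K a b 0 p = (βL²)⁻¹·Σ_ν a(ν,p)·b(ν,p)·‖ĝ_K(ν,p)‖²`** (`klBubbleMass_pin_eq`); hence the pinned transfer weight of an even member `φ` is
  **`klTransferWeight β μ K n φ 0 p = −2(βL²)⁻¹·Σ_ν w^K_{Λ_n}(ν,p)·φ(ν,p)·‖ĝ_K(ν,p)‖²`** (`klTransferWeight_pin_eq`), nonpositive for `φ ≥ 0`, `β ≥ 0` with NO frame or depth
  hypothesis (`klTransferWeight_pin_nonpos`) — so the pinned net mass `W_n(0) = −Σ_p t` is the explicit nonnegative overlap `2(βL²)⁻¹Σ_{ν,p} w_{Λ_n}φ‖ĝ_K‖²` and the floor (D3) is a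
  phase-space LOWER bound of that sum (E1's);
* §3 ACROSS TRANSFERS, for symbols even in frequency and momentum and `β ≥ 0`: **`|Σ_p klBubbleMass a b Q p| ≤ ½(Σ_p klBubbleMass a a 0 p + Σ_p klBubbleMass b b 0 p)`**
  (`abs_sum_klBubbleMass_le_half`: termwise `|Re(z·conj w)| ≤ ½(‖z‖² + ‖w‖²)` and the reflection `p ↦ Q − p` of the torus), so the DIAGONAL bubble is maximal at zero transfer,
  **`|Σ_p klBubbleMass a a Q p| ≤ Σ_p klBubbleMass a a 0 p`** (`abs_sum_klBubbleMass_diag_le`), and the symmetrised mixed mass obeys the polarization bound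
  `|Σ_p (klBubbleMass a b Q p + klBubbleMass b a Q p)| ≤ Σ_p klBubbleMass a a 0 p + Σ_p klBubbleMass b b 0 p` (`abs_sum_klBubbleMass_symm_le`), in particular
  `|Σ_p klTransferWeight β μ K n φ Q p| ≤ Σ_p klBubbleMass w_{Λ_n} w_{Λ_n} 0 p + Σ_p klBubbleMass φ φ 0 p` (`abs_sum_klTransferWeight_le`).

Located caveat (same seat, bus ≈07:32Z): the ladder's masses are symmetrised MIXED bubbles hard shell × soft member, for which «maximal at the pin» does NOT hold near the class
edge; §3's polarization bound is by the two DIAGONAL pinned bubbles, not by the mixed pinned mass.  Everything is proved; no definitions; nothing asserts any slot, stub, K3 or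
superconductivity. [folklore]
-/

noncomputable section

namespace Summit.HubbardSuperconductivity.HubbardSuperconductivity.Theorems.KLRegimeSplit

set_option linter.dupNamespace false -- summit = problem name (single-conjunct summit), D-0017

open Real Finset Literature.MathematicalPhysics.QuantumLattice Literature.Probability.LatticeModels
open Literature.MathematicalPhysics.QuantumLattice.FermiRG
open Summit.HubbardSuperconductivity.HubbardSuperconductivity.Theorems.KLProgrammeLegKernels
open Summit.HubbardSuperconductivity.HubbardSuperconductivity.Theorems.TwoPointAssembly
open ComplexConjugate

variable {L M : ℕ} (β μ : ℝ) (K : TrigPolyC4v)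

/-! ## §1 Symmetries of the rung and the conj form of the pair sum -/

/-- The frame propagator is even in the momentum: `ĝ_K(ν, −p) = ĝ_K(ν, p)` (`e_K` is even). [folklore] -/
theorem propCT_neg_momentum [NeZero L] (ν : MatsubaraIdx M) (p : TorusSite 2 L) :
    propCT L M β μ K (ν, -p) = propCT L M β μ K (ν, p) := by
  simp only [propCT, nambuXiCT_neg]

/-- The CT cutoff weight is even in the momentum alone: `w^K_Λ(ν, −p) = w^K_Λ(ν, p)`. [folklore] -/
theorem hubbardCutoffWeightCT_neg_momentum [NeZero L] (Λ : ℝ) (ν : MatsubaraIdx M) (p : TorusSite 2 L) :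
    hubbardCutoffWeightCT L M β μ K Λ (ν, -p) = hubbardCutoffWeightCT L M β μ K Λ (ν, p) := by
  have h1 : hubbardCutoffWeightCT L M β μ K Λ (FreqMomentum.neg ((ν.rev, p) : FreqMomentum L M)) =
      hubbardCutoffWeightCT L M β μ K Λ (ν.rev, p) :=
    hubbardCutoffWeightCT_neg L M β μ K Λ (ν.rev, p)
  have h2 : FreqMomentum.neg ((ν.rev, p) : FreqMomentum L M) = (ν, -p) := by
    simp only [FreqMomentum.neg, Fin.rev_rev]
  rw [h2] at h1
  rw [h1]
  exact hubbardCutoffWeightCT_revFreq L M β μ K Λ (ν, p)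

/-- **The conj form of the pair mass**: for `b` even in the frequency,
`klBubbleMass β μ K a b Q p = (βL²)⁻¹·Σ_ν Re(g^a_ν(p)·conj g^b_ν(Q − p))`, `g^e_ν(p) = e(ν,p)·ĝ_K(ν,p)`. [folklore] -/
theorem klBubbleMass_eq_re_sum_conj {a b : FreqMomentum L M → ℝ} (hb : ∀ k : FreqMomentum L M, b (k.1.rev, k.2) = b k)
    (Qm p : TorusSite 2 L) :
    klBubbleMass L M β μ K a b Qm p = (β * (L : ℝ) ^ 2)⁻¹ *
      ∑ ν : MatsubaraIdx M, (((a (ν, p) : ℂ) * propCT L M β μ K (ν, p)) * conj ((b (ν, Qm - p) : ℂ) * propCT L M β μ K (ν, Qm - p))).re := by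
  simp only [klBubbleMass, klBubbleSum, Complex.re_sum]
  congr 1
  refine sum_congr rfl fun ν _ => ?_
  have h1 : b (ν.rev, Qm - p) = b (ν, Qm - p) := hb (ν, Qm - p)
  rw [h1, propCT_revFreq β μ K ν (Qm - p)]
  simp only [map_mul, Complex.conj_ofReal]
  push_cast
  ring_nf

/-! ## §2 At the pin: the overlap sum -/

/-- **The pinned pair mass is an overlap sum**: for `b` even in frequency and momentum,
`klBubbleMass β μ K a b 0 p = (βL²)⁻¹·Σ_ν a(ν,p)·b(ν,p)·‖ĝ_K(ν,p)‖²`. [folklore] -/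
theorem klBubbleMass_pin_eq [NeZero L] {a b : FreqMomentum L M → ℝ} (hb : ∀ k : FreqMomentum L M, b (k.1.rev, k.2) = b k)
    (hb' : ∀ k : FreqMomentum L M, b (k.1, -k.2) = b k) (p : TorusSite 2 L) :
    klBubbleMass L M β μ K a b 0 p = (β * (L : ℝ) ^ 2)⁻¹ * ∑ ν : MatsubaraIdx M, a (ν, p) * b (ν, p) * ‖propCT L M β μ K (ν, p)‖ ^ 2 := by
  rw [klBubbleMass_eq_re_sum_conj β μ K hb]
  congr 1
  refine sum_congr rfl fun ν _ => ?_
  have h2 : b (ν, 0 - p) = b (ν, p) := by rw [zero_sub]; exact hb' (ν, p)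
  rw [h2, show ((0 : TorusSite 2 L) - p) = -p from zero_sub p, propCT_neg_momentum β μ K ν p]
  set G := propCT L M β μ K (ν, p)
  simp only [map_mul, Complex.conj_ofReal]
  have : (a (ν, p) : ℂ) * G * ((b (ν, p) : ℂ) * conj G) = ((a (ν, p) * b (ν, p) * Complex.normSq G : ℝ) : ℂ) := by
    rw [show (a (ν, p) : ℂ) * G * ((b (ν, p) : ℂ) * conj G) = (a (ν, p) : ℂ) * (b (ν, p) : ℂ) * (G * conj G) by ring, Complex.mul_conj]
    push_cast; ring
  rw [this, Complex.ofReal_re, Complex.normSq_eq_norm_sq]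

/-- **The pinned transfer weight is minus twice the shell–member overlap**: for a member `φ` even in frequency and momentum,
`klTransferWeight β μ K n φ 0 p = −2(βL²)⁻¹·Σ_ν w^K_{Λ_n}(ν,p)·φ(ν,p)·‖ĝ_K(ν,p)‖²`. [folklore] -/
theorem klTransferWeight_pin_eq [NeZero L] (n : ℕ) {φ : FreqMomentum L M → ℝ} (hφ : ∀ k : FreqMomentum L M, φ (k.1.rev, k.2) = φ k)
    (hφ' : ∀ k : FreqMomentum L M, φ (k.1, -k.2) = φ k) (p : TorusSite 2 L) :
    klTransferWeight L M β μ K n φ 0 p = -(2 * (β * (L : ℝ) ^ 2)⁻¹ *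
      ∑ ν : MatsubaraIdx M, hubbardCutoffWeightCT L M β μ K (klScale klE0 n) (ν, p) * φ (ν, p) * ‖propCT L M β μ K (ν, p)‖ ^ 2) := by
  have hw : ∀ k : FreqMomentum L M, hubbardCutoffWeightCT L M β μ K (klScale klE0 n) (k.1.rev, k.2) = hubbardCutoffWeightCT L M β μ K (klScale klE0 n) k :=
    fun k => hubbardCutoffWeightCT_revFreq L M β μ K _ k
  have hw' : ∀ k : FreqMomentum L M, hubbardCutoffWeightCT L M β μ K (klScale klE0 n) (k.1, -k.2) = hubbardCutoffWeightCT L M β μ K (klScale klE0 n) k :=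
    fun k => hubbardCutoffWeightCT_neg_momentum β μ K _ k.1 k.2
  rw [klTransferWeight_eq_neg_bubbleMass, klBubbleMass_pin_eq β μ K hφ hφ' p, klBubbleMass_pin_eq β μ K hw hw' p, ← mul_add, ← sum_add_distrib]
  have hs : ∑ ν : MatsubaraIdx M, (hubbardCutoffWeightCT L M β μ K (klScale klE0 n) (ν, p) * φ (ν, p) * ‖propCT L M β μ K (ν, p)‖ ^ 2 +
      φ (ν, p) * hubbardCutoffWeightCT L M β μ K (klScale klE0 n) (ν, p) * ‖propCT L M β μ K (ν, p)‖ ^ 2) =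
      2 * ∑ ν : MatsubaraIdx M, hubbardCutoffWeightCT L M β μ K (klScale klE0 n) (ν, p) * φ (ν, p) * ‖propCT L M β μ K (ν, p)‖ ^ 2 := by
    rw [mul_sum]
    exact sum_congr rfl fun ν _ => by ring
  rw [hs]
  ring

/-- **The pinned transfer weight of a nonnegative even member is nonpositive** (`β ≥ 0`; no frame or depth hypothesis): the pinned net mass `−Σ_p t` is the nonnegative
overlap `2(βL²)⁻¹Σ w_{Λ_n}φ‖ĝ_K‖²`. [folklore] -/
theorem klTransferWeight_pin_nonpos [NeZero L] (hβ : 0 ≤ β) (n : ℕ) {φ : FreqMomentum L M → ℝ} (hφ : ∀ k : FreqMomentum L M, φ (k.1.rev, k.2) = φ k)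
    (hφ' : ∀ k : FreqMomentum L M, φ (k.1, -k.2) = φ k) (hφ0 : ∀ k, 0 ≤ φ k) (p : TorusSite 2 L) :
    klTransferWeight L M β μ K n φ 0 p ≤ 0 := by
  rw [klTransferWeight_pin_eq β μ K n hφ hφ' p, neg_nonpos]
  refine mul_nonneg (mul_nonneg (by norm_num) (by positivity)) (sum_nonneg fun ν _ => ?_)
  exact mul_nonneg (mul_nonneg (salmhoferCutoff_mem_Icc _).1 (hφ0 _)) (sq_nonneg _)

/-! ## §3 Across transfers: the diagonal bubble is maximal at the pin; polarization for the mixed mass -/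

/-- Termwise: `|Re(z·conj w)| ≤ ½(‖z‖² + ‖w‖²)`. [folklore] -/
theorem abs_re_mul_conj_le_half (z w : ℂ) : |(z * conj w).re| ≤ (‖z‖ ^ 2 + ‖w‖ ^ 2) / 2 := by
  have h1 : |(z * conj w).re| ≤ ‖z‖ * ‖w‖ := by
    refine (Complex.abs_re_le_norm _).trans (le_of_eq ?_)
    rw [norm_mul, Complex.norm_conj]
  have h2 : 2 * ‖z‖ * ‖w‖ ≤ ‖z‖ ^ 2 + ‖w‖ ^ 2 := two_mul_le_add_sq _ _
  linarith

/-- **Mixed bubble across transfers vs the two pinned diagonal bubbles** (`β ≥ 0`, both symbols even in frequency and momentum):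
`|Σ_p klBubbleMass a b Q p| ≤ ½(Σ_p klBubbleMass a a 0 p + Σ_p klBubbleMass b b 0 p)`. [folklore] -/
theorem abs_sum_klBubbleMass_le_half [NeZero L] (hβ : 0 ≤ β) {a b : FreqMomentum L M → ℝ}
    (ha : ∀ k : FreqMomentum L M, a (k.1.rev, k.2) = a k) (ha' : ∀ k : FreqMomentum L M, a (k.1, -k.2) = a k)
    (hb : ∀ k : FreqMomentum L M, b (k.1.rev, k.2) = b k) (hb' : ∀ k : FreqMomentum L M, b (k.1, -k.2) = b k) (Qm : TorusSite 2 L) :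
    |∑ p, klBubbleMass L M β μ K a b Qm p| ≤ ((∑ p, klBubbleMass L M β μ K a a 0 p) + ∑ p, klBubbleMass L M β μ K b b 0 p) / 2 := by
  set c : ℝ := (β * (L : ℝ) ^ 2)⁻¹ with hc
  have hc0 : 0 ≤ c := by positivity
  set ga : MatsubaraIdx M → TorusSite 2 L → ℂ := fun ν p => (a (ν, p) : ℂ) * propCT L M β μ K (ν, p) with hga
  set gb : MatsubaraIdx M → TorusSite 2 L → ℂ := fun ν p => (b (ν, p) : ℂ) * propCT L M β μ K (ν, p) with hgb
  -- conj form of the mixed mass, norm form of the pinned diagonal masses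
  have hmix : ∀ p, klBubbleMass L M β μ K a b Qm p = c * ∑ ν, (ga ν p * conj (gb ν (Qm - p))).re := fun p =>
    klBubbleMass_eq_re_sum_conj β μ K hb Qm p
  have hnorm : ∀ (e : FreqMomentum L M → ℝ) (ν : MatsubaraIdx M) (p : TorusSite 2 L),
      ‖(e (ν, p) : ℂ) * propCT L M β μ K (ν, p)‖ ^ 2 = e (ν, p) * e (ν, p) * ‖propCT L M β μ K (ν, p)‖ ^ 2 := by
    intro e ν p
    rw [norm_mul, mul_pow, Complex.norm_real, Real.norm_eq_abs, sq_abs, sq]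
  have hda : ∑ p, klBubbleMass L M β μ K a a 0 p = c * ∑ p, ∑ ν, ‖ga ν p‖ ^ 2 := by
    rw [mul_sum]
    refine sum_congr rfl fun p _ => ?_
    rw [klBubbleMass_pin_eq β μ K ha ha' p]
    exact congrArg (c * ·) (sum_congr rfl fun ν _ => by rw [hga, hnorm])
  have hdb : ∑ p, klBubbleMass L M β μ K b b 0 p = c * ∑ p, ∑ ν, ‖gb ν p‖ ^ 2 := by
    rw [mul_sum]
    refine sum_congr rfl fun p _ => ?_
    rw [klBubbleMass_pin_eq β μ K hb hb' p]
    exact congrArg (c * ·) (sum_congr rfl fun ν _ => by rw [hgb, hnorm])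
  -- reflection of the torus `p ↦ Q − p`
  have hrefl : ∑ p, ∑ ν, ‖gb ν (Qm - p)‖ ^ 2 = ∑ p, ∑ ν, ‖gb ν p‖ ^ 2 :=
    Fintype.sum_equiv (Equiv.subLeft Qm) (fun p => ∑ ν, ‖gb ν (Qm - p)‖ ^ 2) (fun p => ∑ ν, ‖gb ν p‖ ^ 2) fun p => rfl
  calc |∑ p, klBubbleMass L M β μ K a b Qm p| = |c * ∑ p, ∑ ν, (ga ν p * conj (gb ν (Qm - p))).re| := by
        rw [sum_congr rfl fun p _ => hmix p, ← mul_sum]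
    _ = c * |∑ p, ∑ ν, (ga ν p * conj (gb ν (Qm - p))).re| := by rw [abs_mul, abs_of_nonneg hc0]
    _ ≤ c * ∑ p, ∑ ν, |(ga ν p * conj (gb ν (Qm - p))).re| := by
        refine mul_le_mul_of_nonneg_left ((abs_sum_le_sum_abs _ _).trans (sum_le_sum fun p _ => abs_sum_le_sum_abs _ _)) hc0
    _ ≤ c * ∑ p, ∑ ν, (‖ga ν p‖ ^ 2 + ‖gb ν (Qm - p)‖ ^ 2) / 2 :=
        mul_le_mul_of_nonneg_left (sum_le_sum fun p _ => sum_le_sum fun ν _ => abs_re_mul_conj_le_half _ _) hc0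
    _ = c * ((∑ p, ∑ ν, ‖ga ν p‖ ^ 2 + ∑ p, ∑ ν, ‖gb ν (Qm - p)‖ ^ 2) / 2) := by
        congr 1
        rw [← sum_add_distrib, Finset.sum_div]
        exact sum_congr rfl fun p _ => by rw [← sum_add_distrib, Finset.sum_div]
    _ = ((∑ p, klBubbleMass L M β μ K a a 0 p) + ∑ p, klBubbleMass L M β μ K b b 0 p) / 2 := by
        rw [hrefl, hda, hdb]; ring

/-- **The diagonal bubble of an even symbol is maximal at zero transfer** (`β ≥ 0`): `|Σ_p klBubbleMass a a Q p| ≤ Σ_p klBubbleMass a a 0 p`. [folklore] -/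
theorem abs_sum_klBubbleMass_diag_le [NeZero L] (hβ : 0 ≤ β) {a : FreqMomentum L M → ℝ}
    (ha : ∀ k : FreqMomentum L M, a (k.1.rev, k.2) = a k) (ha' : ∀ k : FreqMomentum L M, a (k.1, -k.2) = a k) (Qm : TorusSite 2 L) :
    |∑ p, klBubbleMass L M β μ K a a Qm p| ≤ ∑ p, klBubbleMass L M β μ K a a 0 p := by
  have h := abs_sum_klBubbleMass_le_half β μ K hβ ha ha' ha ha' Qm
  linarith

/-- The pinned diagonal bubble of an even symbol is nonnegative (`β ≥ 0`). [folklore] -/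
theorem sum_klBubbleMass_diag_pin_nonneg [NeZero L] (hβ : 0 ≤ β) {a : FreqMomentum L M → ℝ}
    (ha : ∀ k : FreqMomentum L M, a (k.1.rev, k.2) = a k) (ha' : ∀ k : FreqMomentum L M, a (k.1, -k.2) = a k) :
    0 ≤ ∑ p, klBubbleMass L M β μ K a a 0 p :=
  (abs_nonneg _).trans (abs_sum_klBubbleMass_diag_le β μ K hβ ha ha' 0)

/-- **Polarization for the symmetrised mixed mass** (`β ≥ 0`, both symbols even in frequency and momentum):
`|Σ_p (klBubbleMass a b Q p + klBubbleMass b a Q p)| ≤ Σ_p klBubbleMass a a 0 p + Σ_p klBubbleMass b b 0 p`. [folklore] -/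
theorem abs_sum_klBubbleMass_symm_le [NeZero L] (hβ : 0 ≤ β) {a b : FreqMomentum L M → ℝ}
    (ha : ∀ k : FreqMomentum L M, a (k.1.rev, k.2) = a k) (ha' : ∀ k : FreqMomentum L M, a (k.1, -k.2) = a k)
    (hb : ∀ k : FreqMomentum L M, b (k.1.rev, k.2) = b k) (hb' : ∀ k : FreqMomentum L M, b (k.1, -k.2) = b k) (Qm : TorusSite 2 L) :
    |∑ p, (klBubbleMass L M β μ K a b Qm p + klBubbleMass L M β μ K b a Qm p)| ≤
      (∑ p, klBubbleMass L M β μ K a a 0 p) + ∑ p, klBubbleMass L M β μ K b b 0 p := by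
  rw [sum_add_distrib]
  have h1 := abs_sum_klBubbleMass_le_half β μ K hβ ha ha' hb hb' Qm
  have h2 := abs_sum_klBubbleMass_le_half β μ K hβ hb hb' ha ha' Qm
  refine (abs_add_le _ _).trans ?_
  linarith

/-- **The transfer mass of an even member across transfers vs the two pinned diagonal bubbles** (`β ≥ 0`):
`|Σ_p klTransferWeight β μ K n φ Q p| ≤ Σ_p klBubbleMass w^K_{Λ_n} w^K_{Λ_n} 0 p + Σ_p klBubbleMass φ φ 0 p`. [folklore] -/
theorem abs_sum_klTransferWeight_le [NeZero L] (hβ : 0 ≤ β) (n : ℕ) {φ : FreqMomentum L M → ℝ}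
    (hφ : ∀ k : FreqMomentum L M, φ (k.1.rev, k.2) = φ k) (hφ' : ∀ k : FreqMomentum L M, φ (k.1, -k.2) = φ k) (Qm : TorusSite 2 L) :
    |∑ p, klTransferWeight L M β μ K n φ Qm p| ≤
      (∑ p, klBubbleMass L M β μ K (hubbardCutoffWeightCT L M β μ K (klScale klE0 n)) (hubbardCutoffWeightCT L M β μ K (klScale klE0 n)) 0 p) +
        ∑ p, klBubbleMass L M β μ K φ φ 0 p := by
  have hw : ∀ k : FreqMomentum L M, hubbardCutoffWeightCT L M β μ K (klScale klE0 n) (k.1.rev, k.2) = hubbardCutoffWeightCT L M β μ K (klScale klE0 n) k :=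
    fun k => hubbardCutoffWeightCT_revFreq L M β μ K _ k
  have hw' : ∀ k : FreqMomentum L M, hubbardCutoffWeightCT L M β μ K (klScale klE0 n) (k.1, -k.2) = hubbardCutoffWeightCT L M β μ K (klScale klE0 n) k :=
    fun k => hubbardCutoffWeightCT_neg_momentum β μ K _ k.1 k.2
  have heq : ∑ p, klTransferWeight L M β μ K n φ Qm p =
      -∑ p, (klBubbleMass L M β μ K (hubbardCutoffWeightCT L M β μ K (klScale klE0 n)) φ Qm p +
        klBubbleMass L M β μ K φ (hubbardCutoffWeightCT L M β μ K (klScale klE0 n)) Qm p) := by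
    rw [← sum_neg_distrib]
    exact sum_congr rfl fun p _ => klTransferWeight_eq_neg_bubbleMass β μ K n φ Qm p
  rw [heq, abs_neg]
  exact abs_sum_klBubbleMass_symm_le β μ K hβ hw hw' hφ hφ' Qm

end Summit.HubbardSuperconductivity.HubbardSuperconductivity.Theorems.KLRegimeSplit

end
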